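import Summits.BirchSwinnertonDyer.Rank1Residual.WAll.TargetAdditiveAtThreePotSS
import HarnessLib
import HarnessLib.Audit.Tags

/-!
# Rung W-ALL of ladder BSD (D-0120) — row 2 at `p = 3`, BLOCK A (rank one, potentially supersingular)
# cut by the IMAGE OF `ρ̄_{E,3}` (cell `bsd-wall`, lane (2), seat `bsd-wall-ty-1`; new small file
# importing `WAll.TargetAdditiveAtThreePotSS`)

HONEST FRAMING (cell `bsd-wall`, run/shared/lean/pub/bsd-wall/; brief `WALL-BRIEF-v1.md` sha16
b966bf16da27706e §2): STATEMENTS AND BOOKKEEPING ONLY — nothing asserted, nothing booked, no named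
fact, no published theorem restated; every `@[conjecture] def` below is an OPEN obligation and a
SLICE of the registered block-A leaf `WAllExclAddPotSSAtThreeRankOne` (`TargetAdditiveAtThreePotSS.lean`,
«W-ALL/2@3.potss.r1»: non-CM `E/ℚ`, additive at `3` of potentially supersingular type —
`Additive.ClassO5 W 3` (tame: `(G) ∧ ss`, `e = 2`, or `(t′)`, `e = 4`) or `Additive.ClassO6 W 3` (wild) —,
`ord_{s=1} L(E,s) = 1` ⇒ `BSD(E,3)`), hence of row 2 `WAllExclAdditive` and of `WAll`.

WHY THESE NAMES. The census seat's block-A dossier of record (`bsd-wall-census/BLOCK-A-R1POTSS3-DOSSIER-v1.md`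
rev 2 sha16 ffc5ad03e4723116, 2026-08-27T07:15Z (rev 1 5e9c56e3aed4f606 + §7); register A2 ROUND 494, `N < 5·10⁵`, unit = isogeny class;
`18 166` classes = `17 461` at `r = 1` + the `705` rank-`0` `(G) ∧ ss` classes it keeps visible) cuts
block A by the IMAGE of the mod-`3` representation (Cremona `galrep`), and finds three different walls
(dossier §6 «Block A is not one wall but three»):

| sub-block | typed image predicate (`Rank1Residual/Predicates.lean`) | classes (dossier §1) | dossier's reading of what is missing (§2–§4) |
|---|---|---|---|
| A1 | `Red W 3` (`E[3]` reducible, "X3-red", Borel) | `12 081` (`66.5 %`) | no Euler-system bound in print for reducible `E[3]` at an additive `3` (Lawson–Wuthrich 2016 Thm 14 disputed by Matar–Nekovář 2019 §0.11; `5 705` classes carry rational `3`-torsion in the class, excluded even there); no main conjecture, no `3`-adic `L`-function |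
| A2 | `Surj W 3` (`ρ̄_{E,3}` onto `GL₂(𝔽₃)`, "X4-onto") | `5 534` (`4 882` at `r = 1`) | ONE conjecture deep on the Heegner side: Jetchev's Conj. 1.3 divisibility half `m_∞ ≥ ord₃ ∏ c_q` read at `3 ∣ N` (typed carrier `Rank1Residual.AdditiveThree.RKC3Divisibility`) for `4 227 + …` classes, its indivisibility twin for `630 + 25` |
| A3 | `Irr W 3 ∧ ¬ Surj W 3` (Cartan-normaliser images "3Nn"/"3Ns") | `551` (`498` at `r = 1`) | the same plus an irreducible-not-onto reading of Jetchev's Cor. 1.5 (untyped at `r = 1`) |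

A route born on block A (seat `bsd-wall-pss3`, director DECISION 2026-08-27T06:42:48Z) that attacks ONE
of these walls should `--closes-target` the matching leaf and leave the others as named leaves, not as
a restated residual; this file names them — the three image blocks, the irreducible block A2 ∪ A3
(`Irr W 3`, the block-A part of the registered sub-leaf `WAllExclX4`; A1 is the block-A part of
`WAllExclX3`), and the image × local-type atoms (tame `ClassO5` / wild `ClassO6`, the two type leaves
`WAllExclAddTameSSAtThreeRankOne` / `WAllExclAddWildRankOne` of `TargetAdditiveAtThreeCells.lean`) —
and PROVES, by case splits only (`Red W 3 ↔ ¬ Irr W 3` is `Iff.rfl`; excluded middle on `Irr W 3` and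
on `Surj W 3`): block A ⟺ A1 ∧ A2 ∧ A3 ⟺ A1 ∧ (A2 ∪ A3); A2 ∪ A3 ⟺ A2 ∧ A3; every block ⟺ its
tame and wild atoms; each type leaf ⟺ its three image atoms; everything here ⇐ block A ⇐ `WAll`;
§4: A1 ⇐ the registered sub-leaf `WAllExclX3` and A2 ∪ A3 ⇐ `WAllExclX4`, by name.
The implication «onto ⇒ irreducible» is the tree THEOREM
`Literature.NumberTheory.EllipticCurves.hasIrreducibleModPGaloisRep_of_hasSurjectiveModNGaloisRep`
(`NonEisensteinPrimeOfSurjective.lean`, proved); it is NOT imported into this statement file (its module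
sits on the open-image / conductor cone) and enters below only as the displayed hypothesis `hsi` of
`wAllExclAddPotSSAtThreeRankOneSurj_of_irr`, discharged by that theorem at the point of use. The exact
covers do not need it.

Not typed here (dossier §4 (u1)–(u3), §7): the Heegner-index SHAPES (JET-PRODUCT / INDEX-EXCESS /
SHA3 — certificate data per class, not class predicates), the rational-`3`-torsion sub-configuration of
A1, and the `(G) ∧ ss` base-change identity of dossier §7 (mathematics, to be typed by whoever uses it).

References: `WAll/TargetAdditiveAtThreePotSS.lean` (block A and glue), `WAll/TargetAdditiveAtThreeCells.lean`
(type × rank atoms at `3`), `WAll/TargetPrimeSlices.lean`, `WAll/Target.lean` (`WAllExclX3` / `WAllExclX4`);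
`Rank1Residual/Predicates.lean` (`Irr`, `Red`, `Surj`, `red_iff`); HOME
`bsd-wall-census/BLOCK-A-R1POTSS3-DOSSIER-v1.md` §1–§7, `ROW2-AT3-SCOPING-v1.md` v1.4;
[cite: Miller2011LMS, §1 and Def. 1.1] (the currency `BSD(E,p)`).
-/

noncomputable section

open scoped Classical

open WeierstrassCurve Literature.NumberTheory.EllipticCurves
  Literature.NumberTheory.EllipticCurves.Rank1Residual Literature.NumberTheory.EllipticCurves.ModularForms
open Summit.BirchSwinnertonDyer.Rank1Residual

set_option autoImplicit false

namespace Summit.BirchSwinnertonDyer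

/-! ### §1. Block A (rank one, potentially supersingular additive `3`) by the image of `ρ̄_{E,3}` -/

/-- **Block A1 — reducible `E[3]` (OPEN).** Non-CM `E/ℚ` (globally minimal `W`), additive at `3` of
potentially supersingular type (`Additive.ClassO5 W 3 ∨ Additive.ClassO6 W 3`), `ρ̄_{E,3}` REDUCIBLE
(`Red W 3`), `ord_{s=1} L(E,s) = 1` ⇒ `BSD(E,3)`. Dossier sub-block A1 ("X3-red"): `12 081` classes of
record, `66.5 %` of block A; no printed instrument at all (dossier §2/§3 A1). The block-A part of the
registered sub-leaf `WAllExclX3`. [folklore] -/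
@[conjecture] def WAllExclAddPotSSAtThreeRankOneRed : Prop :=
  ∀ (W : WeierstrassCurve ℚ) [W.IsElliptic] [W.IsGloballyMinimal],
    ¬ W.HasCM → Additive.ClassO5 W 3 ∨ Additive.ClassO6 W 3 → Red W 3 → W.analyticRank = 1 → BSDp W 3

/-- **Block A2 ∪ A3 — irreducible `E[3]` (OPEN).** Non-CM, potentially supersingular additive `3`,
`ρ̄_{E,3}` IRREDUCIBLE (`Irr W 3`), `r = 1` ⇒ `BSD(E,3)`. `5 534 + 551` classes of record (`4 882 + 498`
at `r = 1`). The block-A part of the registered sub-leaf `WAllExclX4`; Kolyvagin's upper bound is in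
print here (Gross 1991 Prop. 2.1 for onto, Matar–Nekovář 2019 Thm 0.3 for irreducible; dossier §3).
[folklore] -/
@[conjecture] def WAllExclAddPotSSAtThreeRankOneIrr : Prop :=
  ∀ (W : WeierstrassCurve ℚ) [W.IsElliptic] [W.IsGloballyMinimal],
    ¬ W.HasCM → Additive.ClassO5 W 3 ∨ Additive.ClassO6 W 3 → Irr W 3 → W.analyticRank = 1 → BSDp W 3

/-- **Block A2 — `ρ̄_{E,3}` onto `GL₂(𝔽₃)` (OPEN).** Non-CM, potentially supersingular additive `3`,
`Surj W 3`, `r = 1` ⇒ `BSD(E,3)`. Dossier sub-block A2 ("X4-onto"): `5 534` classes (`4 882` at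
`r = 1`, all at `N > 10⁵` but two); «ONE conjecture deep on the Heegner side»: `4 227` classes are
JET-PRODUCT (`i₃ = t₃ ≥ 2`, closed by Jetchev's Conj. 1.3 divisibility half at `3 ∣ N`, typed carrier
`Rank1Residual.AdditiveThree.RKC3Divisibility`), `630` INDEX-EXCESS + `25` SHA3 need the indivisibility
half too (dossier §2, §6). [folklore] -/
@[conjecture] def WAllExclAddPotSSAtThreeRankOneSurj : Prop :=
  ∀ (W : WeierstrassCurve ℚ) [W.IsElliptic] [W.IsGloballyMinimal],
    ¬ W.HasCM → Additive.ClassO5 W 3 ∨ Additive.ClassO6 W 3 → Surj W 3 → W.analyticRank = 1 → BSDp W 3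

/-- **Block A3 — irreducible, not onto (Cartan-normaliser image at `3`) (OPEN).** Non-CM, potentially
supersingular additive `3`, `Irr W 3`, `¬ Surj W 3`, `r = 1` ⇒ `BSD(E,3)`. Dossier sub-block A3
("X4-3Nn" `441` + "X4-3Ns" `110` classes; `498` at `r = 1`): Kolyvagin's bound is in print for
irreducible `ρ̄₃`, Jetchev's Tamagawa sharpening with irreducible-not-onto image only under Cha's
`p² ∤ N` — «Cor 1.5 with Cartan-normaliser image at an additive `p`, rank 1: not in print, not typed»
(dossier §2/§3 A3, §4 (u1)). [folklore] -/
@[conjecture] def WAllExclAddPotSSAtThreeRankOneIrrNotSurj : Prop :=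
  ∀ (W : WeierstrassCurve ℚ) [W.IsElliptic] [W.IsGloballyMinimal],
    ¬ W.HasCM → Additive.ClassO5 W 3 ∨ Additive.ClassO6 W 3 → Irr W 3 → ¬ Surj W 3 →
      W.analyticRank = 1 → BSDp W 3

/-! ### §2. Image × local type atoms (tame `ClassO5` / wild `ClassO6`), rank one -/

/-- Tame potentially supersingular additive `3` (`Additive.ClassO5 W 3`: `(G) ∧ ss` or `(t′)`),
reducible `E[3]`, `r = 1` ⇒ `BSD(E,3)` (OPEN; dossier T′/X3 `2 705` classes + the `(G) ∧ ss`
reducible share). Slice of `WAllExclAddTameSSAtThreeRankOne`. [folklore] -/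
@[conjecture] def WAllExclAddTameSSAtThreeRankOneRed : Prop :=
  ∀ (W : WeierstrassCurve ℚ) [W.IsElliptic] [W.IsGloballyMinimal],
    ¬ W.HasCM → Additive.ClassO5 W 3 → Red W 3 → W.analyticRank = 1 → BSDp W 3

/-- Tame potentially supersingular additive `3`, `ρ̄_{E,3}` onto, `r = 1` ⇒ `BSD(E,3)` (OPEN; dossier
T′/onto `731` + `(G) ∧ ss`/onto `909` classes, `652` of the latter at `r = 0`). [folklore] -/
@[conjecture] def WAllExclAddTameSSAtThreeRankOneSurj : Prop :=
  ∀ (W : WeierstrassCurve ℚ) [W.IsElliptic] [W.IsGloballyMinimal],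
    ¬ W.HasCM → Additive.ClassO5 W 3 → Surj W 3 → W.analyticRank = 1 → BSDp W 3

/-- Tame potentially supersingular additive `3`, irreducible not onto, `r = 1` ⇒ `BSD(E,3)` (OPEN;
dossier T′/3Nn `97` + `(G) ∧ ss`/3Nn `151` classes). [folklore] -/
@[conjecture] def WAllExclAddTameSSAtThreeRankOneIrrNotSurj : Prop :=
  ∀ (W : WeierstrassCurve ℚ) [W.IsElliptic] [W.IsGloballyMinimal],
    ¬ W.HasCM → Additive.ClassO5 W 3 → Irr W 3 → ¬ Surj W 3 → W.analyticRank = 1 → BSDp W 3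

/-- Wild additive `3` (`Additive.ClassO6 W 3`), reducible `E[3]`, `r = 1` ⇒ `BSD(E,3)` (OPEN; dossier
W/X3 `9 376` classes). Slice of `WAllExclAddWildRankOne` (item 19200 `WildRankOne` territory, rung K9).
[folklore] -/
@[conjecture] def WAllExclAddWildRankOneRed : Prop :=
  ∀ (W : WeierstrassCurve ℚ) [W.IsElliptic] [W.IsGloballyMinimal],
    ¬ W.HasCM → Additive.ClassO6 W 3 → Red W 3 → W.analyticRank = 1 → BSDp W 3

/-- Wild additive `3`, `ρ̄_{E,3}` onto, `r = 1` ⇒ `BSD(E,3)` (OPEN; dossier W/onto `3 894` classes).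
[folklore] -/
@[conjecture] def WAllExclAddWildRankOneSurj : Prop :=
  ∀ (W : WeierstrassCurve ℚ) [W.IsElliptic] [W.IsGloballyMinimal],
    ¬ W.HasCM → Additive.ClassO6 W 3 → Surj W 3 → W.analyticRank = 1 → BSDp W 3

/-- Wild additive `3`, irreducible not onto, `r = 1` ⇒ `BSD(E,3)` (OPEN; dossier W/3Nn `193` + W/3Ns
`110` classes). [folklore] -/
@[conjecture] def WAllExclAddWildRankOneIrrNotSurj : Prop :=
  ∀ (W : WeierstrassCurve ℚ) [W.IsElliptic] [W.IsGloballyMinimal],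
    ¬ W.HasCM → Additive.ClassO6 W 3 → Irr W 3 → ¬ Surj W 3 → W.analyticRank = 1 → BSDp W 3

/-! ### §3. Glue (no mathematics: `red_iff : Red W p ↔ ¬ Irr W p` is `Iff.rfl`, plus case splits) -/

/-- **Block A ⟺ A1 ∧ (A2 ∪ A3)** (reducible ∧ irreducible; excluded middle on `Irr W 3`). [folklore] -/
theorem wAllExclAddPotSSAtThreeRankOne_iff_red_irr :
    WAllExclAddPotSSAtThreeRankOne ↔
      WAllExclAddPotSSAtThreeRankOneRed ∧ WAllExclAddPotSSAtThreeRankOneIrr :=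
  ⟨fun h ↦ ⟨fun W _ _ hcm hO _ hr ↦ h W hcm hO hr, fun W _ _ hcm hO _ hr ↦ h W hcm hO hr⟩,
    fun ⟨hR, hI⟩ W _ _ hcm hO hr ↦ by
      by_cases hirr : Irr W 3
      · exact hI W hcm hO hirr hr
      · exact hR W hcm hO hirr hr⟩

/-- **Block A ⟺ A1 ∧ A2 ∧ A3** — the dossier's three walls are EXACTLY block A (excluded middle on
`Irr W 3`, then on `Surj W 3`; the onto leaf is used only on onto curves, so «onto ⇒ irreducible» is
not needed). [folklore] -/
theorem wAllExclAddPotSSAtThreeRankOne_iff_images :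
    WAllExclAddPotSSAtThreeRankOne ↔
      WAllExclAddPotSSAtThreeRankOneRed ∧ WAllExclAddPotSSAtThreeRankOneSurj ∧
        WAllExclAddPotSSAtThreeRankOneIrrNotSurj :=
  ⟨fun h ↦ ⟨fun W _ _ hcm hO _ hr ↦ h W hcm hO hr, fun W _ _ hcm hO _ hr ↦ h W hcm hO hr,
      fun W _ _ hcm hO _ _ hr ↦ h W hcm hO hr⟩,
    fun ⟨hR, hS, hN⟩ W _ _ hcm hO hr ↦ by
      by_cases hirr : Irr W 3
      · by_cases hs : Surj W 3
        · exact hS W hcm hO hs hr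
        · exact hN W hcm hO hirr hs hr
      · exact hR W hcm hO hirr hr⟩

/-- A2 ∧ A3 ⇒ the irreducible block A2 ∪ A3 (excluded middle on `Surj W 3`). [folklore] -/
theorem wAllExclAddPotSSAtThreeRankOneIrr_of_surj_of_irrNotSurj
    (hS : WAllExclAddPotSSAtThreeRankOneSurj) (hN : WAllExclAddPotSSAtThreeRankOneIrrNotSurj) :
    WAllExclAddPotSSAtThreeRankOneIrr := fun W _ _ hcm hO hirr hr ↦ by
  by_cases hs : Surj W 3
  · exact hS W hcm hO hs hr
  · exact hN W hcm hO hirr hs hr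

/-- The irreducible block restricts to A3. [folklore] -/
theorem wAllExclAddPotSSAtThreeRankOneIrrNotSurj_of_irr (h : WAllExclAddPotSSAtThreeRankOneIrr) :
    WAllExclAddPotSSAtThreeRankOneIrrNotSurj := fun W _ _ hcm hO hirr _ hr ↦ h W hcm hO hirr hr

/-- The irreducible block restricts to A2 GIVEN «onto ⇒ irreducible» at `3`, displayed as the
hypothesis `hsi` — discharged by the tree theorem
`Literature.NumberTheory.EllipticCurves.hasIrreducibleModPGaloisRep_of_hasSurjectiveModNGaloisRep W 3`
(`NonEisensteinPrimeOfSurjective.lean`; not imported into this statement file). [folklore] -/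
theorem wAllExclAddPotSSAtThreeRankOneSurj_of_irr
    (hsi : ∀ (W : WeierstrassCurve ℚ) [W.IsElliptic], Surj W 3 → Irr W 3)
    (h : WAllExclAddPotSSAtThreeRankOneIrr) : WAllExclAddPotSSAtThreeRankOneSurj :=
  fun W _ _ hcm hO hs hr ↦ h W hcm hO (hsi W hs) hr

/-- Under «onto ⇒ irreducible» (hypothesis `hsi`, see `wAllExclAddPotSSAtThreeRankOneSurj_of_irr`):
A2 ∪ A3 ⟺ A2 ∧ A3. [folklore] -/
theorem wAllExclAddPotSSAtThreeRankOneIrr_iff_surj_irrNotSurj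
    (hsi : ∀ (W : WeierstrassCurve ℚ) [W.IsElliptic], Surj W 3 → Irr W 3) :
    WAllExclAddPotSSAtThreeRankOneIrr ↔
      WAllExclAddPotSSAtThreeRankOneSurj ∧ WAllExclAddPotSSAtThreeRankOneIrrNotSurj :=
  ⟨fun h ↦ ⟨wAllExclAddPotSSAtThreeRankOneSurj_of_irr hsi h,
      wAllExclAddPotSSAtThreeRankOneIrrNotSurj_of_irr h⟩,
    fun ⟨hS, hN⟩ ↦ wAllExclAddPotSSAtThreeRankOneIrr_of_surj_of_irrNotSurj hS hN⟩

/-! #### Image blocks ⟺ their tame and wild atoms -/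

/-- A1 ⟺ tame-reducible ∧ wild-reducible. [folklore] -/
theorem wAllExclAddPotSSAtThreeRankOneRed_iff :
    WAllExclAddPotSSAtThreeRankOneRed ↔
      WAllExclAddTameSSAtThreeRankOneRed ∧ WAllExclAddWildRankOneRed :=
  ⟨fun h ↦ ⟨fun W _ _ hcm hO hi hr ↦ h W hcm (Or.inl hO) hi hr,
      fun W _ _ hcm hO hi hr ↦ h W hcm (Or.inr hO) hi hr⟩,
    fun ⟨h5, h6⟩ W _ _ hcm hO hi hr ↦
      hO.elim (fun hO ↦ h5 W hcm hO hi hr) (fun hO ↦ h6 W hcm hO hi hr)⟩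

/-- A2 ⟺ tame-onto ∧ wild-onto. [folklore] -/
theorem wAllExclAddPotSSAtThreeRankOneSurj_iff :
    WAllExclAddPotSSAtThreeRankOneSurj ↔
      WAllExclAddTameSSAtThreeRankOneSurj ∧ WAllExclAddWildRankOneSurj :=
  ⟨fun h ↦ ⟨fun W _ _ hcm hO hi hr ↦ h W hcm (Or.inl hO) hi hr,
      fun W _ _ hcm hO hi hr ↦ h W hcm (Or.inr hO) hi hr⟩,
    fun ⟨h5, h6⟩ W _ _ hcm hO hi hr ↦
      hO.elim (fun hO ↦ h5 W hcm hO hi hr) (fun hO ↦ h6 W hcm hO hi hr)⟩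

/-- A3 ⟺ tame-normaliser ∧ wild-normaliser. [folklore] -/
theorem wAllExclAddPotSSAtThreeRankOneIrrNotSurj_iff :
    WAllExclAddPotSSAtThreeRankOneIrrNotSurj ↔
      WAllExclAddTameSSAtThreeRankOneIrrNotSurj ∧ WAllExclAddWildRankOneIrrNotSurj :=
  ⟨fun h ↦ ⟨fun W _ _ hcm hO hi hs hr ↦ h W hcm (Or.inl hO) hi hs hr,
      fun W _ _ hcm hO hi hs hr ↦ h W hcm (Or.inr hO) hi hs hr⟩,
    fun ⟨h5, h6⟩ W _ _ hcm hO hi hs hr ↦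
      hO.elim (fun hO ↦ h5 W hcm hO hi hs hr) (fun hO ↦ h6 W hcm hO hi hs hr)⟩

/-! #### Type leaves of `TargetAdditiveAtThreeCells.lean` ⟺ their three image atoms -/

/-- O5@3.r1 (`WAllExclAddTameSSAtThreeRankOne`) ⟺ its reducible, onto and normaliser atoms. [folklore] -/
theorem wAllExclAddTameSSAtThreeRankOne_iff_images :
    WAllExclAddTameSSAtThreeRankOne ↔
      WAllExclAddTameSSAtThreeRankOneRed ∧ WAllExclAddTameSSAtThreeRankOneSurj ∧
        WAllExclAddTameSSAtThreeRankOneIrrNotSurj :=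
  ⟨fun h ↦ ⟨fun W _ _ hcm hO _ hr ↦ h W hcm hO hr, fun W _ _ hcm hO _ hr ↦ h W hcm hO hr,
      fun W _ _ hcm hO _ _ hr ↦ h W hcm hO hr⟩,
    fun ⟨hR, hS, hN⟩ W _ _ hcm hO hr ↦ by
      by_cases hirr : Irr W 3
      · by_cases hs : Surj W 3
        · exact hS W hcm hO hs hr
        · exact hN W hcm hO hirr hs hr
      · exact hR W hcm hO hirr hr⟩

/-- O6.r1 (`WAllExclAddWildRankOne`) ⟺ its reducible, onto and normaliser atoms. [folklore] -/
theorem wAllExclAddWildRankOne_iff_images :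
    WAllExclAddWildRankOne ↔
      WAllExclAddWildRankOneRed ∧ WAllExclAddWildRankOneSurj ∧ WAllExclAddWildRankOneIrrNotSurj :=
  ⟨fun h ↦ ⟨fun W _ _ hcm hO _ hr ↦ h W hcm hO hr, fun W _ _ hcm hO _ hr ↦ h W hcm hO hr,
      fun W _ _ hcm hO _ _ hr ↦ h W hcm hO hr⟩,
    fun ⟨hR, hS, hN⟩ W _ _ hcm hO hr ↦ by
      by_cases hirr : Irr W 3
      · by_cases hs : Surj W 3
        · exact hS W hcm hO hs hr
        · exact hN W hcm hO hirr hs hr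
      · exact hR W hcm hO hirr hr⟩

/-- **Block A ⟺ its six image × type atoms.** [folklore] -/
theorem wAllExclAddPotSSAtThreeRankOne_iff_atoms :
    WAllExclAddPotSSAtThreeRankOne ↔
      (WAllExclAddTameSSAtThreeRankOneRed ∧ WAllExclAddTameSSAtThreeRankOneSurj ∧
        WAllExclAddTameSSAtThreeRankOneIrrNotSurj) ∧
      (WAllExclAddWildRankOneRed ∧ WAllExclAddWildRankOneSurj ∧ WAllExclAddWildRankOneIrrNotSurj) := by
  rw [wAllExclAddPotSSAtThreeRankOne_iff, wAllExclAddTameSSAtThreeRankOne_iff_images,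
    wAllExclAddWildRankOne_iff_images]

/-! #### Everything here follows from block A, hence from `WAll` -/

/-- Block A restricts to its four image blocks. [folklore] -/
theorem images_of_wAllExclAddPotSSAtThreeRankOne (h : WAllExclAddPotSSAtThreeRankOne) :
    WAllExclAddPotSSAtThreeRankOneRed ∧ WAllExclAddPotSSAtThreeRankOneIrr ∧
      WAllExclAddPotSSAtThreeRankOneSurj ∧ WAllExclAddPotSSAtThreeRankOneIrrNotSurj :=
  ⟨(wAllExclAddPotSSAtThreeRankOne_iff_red_irr.1 h).1, (wAllExclAddPotSSAtThreeRankOne_iff_red_irr.1 h).2,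
    (wAllExclAddPotSSAtThreeRankOne_iff_images.1 h).2.1, (wAllExclAddPotSSAtThreeRankOne_iff_images.1 h).2.2⟩

/-- Block A restricts to its six image × type atoms. [folklore] -/
theorem atoms_of_wAllExclAddPotSSAtThreeRankOne (h : WAllExclAddPotSSAtThreeRankOne) :
    (WAllExclAddTameSSAtThreeRankOneRed ∧ WAllExclAddTameSSAtThreeRankOneSurj ∧
        WAllExclAddTameSSAtThreeRankOneIrrNotSurj) ∧
      (WAllExclAddWildRankOneRed ∧ WAllExclAddWildRankOneSurj ∧ WAllExclAddWildRankOneIrrNotSurj) :=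
  wAllExclAddPotSSAtThreeRankOne_iff_atoms.1 h

/-- The four image blocks follow from `WAll` (each is an instance of it). [folklore] -/
theorem potSSAtThreeRankOneImages_of_wAll (h : WAll) :
    WAllExclAddPotSSAtThreeRankOneRed ∧ WAllExclAddPotSSAtThreeRankOneIrr ∧
      WAllExclAddPotSSAtThreeRankOneSurj ∧ WAllExclAddPotSSAtThreeRankOneIrrNotSurj :=
  images_of_wAllExclAddPotSSAtThreeRankOne (potSSAtThree_of_wAll h).2.2

/-- **Row 2 at `3`, rank `1` ⟺ (M)@3.r1 ∧ (G-ord)@3.r1 ∧ A1 ∧ A2 ∧ A3** — the K1 cells and the three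
image walls of block A reassemble the registered rank-one slice at `3`. [folklore] -/
theorem wAllExclAdditiveAtThreeRankOne_iff_potMult_potOrd_images :
    WAllExclAdditiveAtThreeRankOne ↔
      WAllExclAddPotMultAtThreeRankOne ∧ WAllExclAddPotOrdAtThreeRankOne ∧
        WAllExclAddPotSSAtThreeRankOneRed ∧ WAllExclAddPotSSAtThreeRankOneSurj ∧
          WAllExclAddPotSSAtThreeRankOneIrrNotSurj := by
  rw [wAllExclAdditiveAtThreeRankOne_iff_potMult_potOrd_potSS, wAllExclAddPotSSAtThreeRankOne_iff_images]

/-- Block A from its three image walls (the form a route on one wall cites to show what it leaves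
named). [folklore] -/
theorem wAllExclAddPotSSAtThreeRankOne_of_images (hR : WAllExclAddPotSSAtThreeRankOneRed)
    (hS : WAllExclAddPotSSAtThreeRankOneSurj) (hN : WAllExclAddPotSSAtThreeRankOneIrrNotSurj) :
    WAllExclAddPotSSAtThreeRankOne :=
  wAllExclAddPotSSAtThreeRankOne_iff_images.2 ⟨hR, hS, hN⟩

/-- Block A from A1 and the irreducible block. [folklore] -/
theorem wAllExclAddPotSSAtThreeRankOne_of_red_of_irr (hR : WAllExclAddPotSSAtThreeRankOneRed)
    (hI : WAllExclAddPotSSAtThreeRankOneIrr) : WAllExclAddPotSSAtThreeRankOne :=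
  wAllExclAddPotSSAtThreeRankOne_iff_red_irr.2 ⟨hR, hI⟩

/-! ### §4. The image blocks under the registered row-2 sub-leaves `WAllExclX3` / `WAllExclX4` -/

/-- **A1 ⇐ `WAllExclX3`**: block A ∧ reducible is additive-reducible at `3` (`ClassX3 W 3 = Red W 3 ∧
Addv W 3`), so the registered sub-leaf of row 2 closes A1 by name. [folklore] -/
theorem wAllExclAddPotSSAtThreeRankOneRed_of_wAllExclX3 (h : WAllExclX3) :
    WAllExclAddPotSSAtThreeRankOneRed := fun W _ _ hcm hO hred hr ↦
  h W 3 hcm (by decide) ⟨hred, hO.elim (fun h5 ↦ h5.2.1) (fun h6 ↦ h6.2.1)⟩ hr.le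

/-- **A2 ∪ A3 ⇐ `WAllExclX4`**: block A ∧ irreducible is additive-irreducible at the odd prime `3`
(`ClassX4 W 3 = 3 ≠ 2 ∧ Addv W 3 ∧ Irr W 3`). [folklore] -/
theorem wAllExclAddPotSSAtThreeRankOneIrr_of_wAllExclX4 (h : WAllExclX4) :
    WAllExclAddPotSSAtThreeRankOneIrr := fun W _ _ hcm hO hirr hr ↦
  h W 3 hcm ⟨by decide, hO.elim (fun h5 ↦ h5.2.1) (fun h6 ↦ h6.2.1), hirr⟩ hr.le

/-- Hence A2 and A3 ⇐ `WAllExclX4` as well (restrictions of the irreducible block; A2 through the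
displayed «onto ⇒ irreducible» hypothesis `hsi`). [folklore] -/
theorem wAllExclAddPotSSAtThreeRankOneIrrNotSurj_of_wAllExclX4 (h : WAllExclX4) :
    WAllExclAddPotSSAtThreeRankOneIrrNotSurj :=
  wAllExclAddPotSSAtThreeRankOneIrrNotSurj_of_irr (wAllExclAddPotSSAtThreeRankOneIrr_of_wAllExclX4 h)

/-- A2 ⇐ `WAllExclX4`, given «onto ⇒ irreducible» (`hsi`). [folklore] -/
theorem wAllExclAddPotSSAtThreeRankOneSurj_of_wAllExclX4
    (hsi : ∀ (W : WeierstrassCurve ℚ) [W.IsElliptic], Surj W 3 → Irr W 3) (h : WAllExclX4) :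
    WAllExclAddPotSSAtThreeRankOneSurj :=
  wAllExclAddPotSSAtThreeRankOneSurj_of_irr hsi (wAllExclAddPotSSAtThreeRankOneIrr_of_wAllExclX4 h)

/-- **Block A ⇐ `WAllExclX3` ∧ `WAllExclX4`** (through A1 and the irreducible block). [folklore] -/
theorem wAllExclAddPotSSAtThreeRankOne_of_wAllExclX3_of_wAllExclX4 (h3 : WAllExclX3) (h4 : WAllExclX4) :
    WAllExclAddPotSSAtThreeRankOne :=
  wAllExclAddPotSSAtThreeRankOne_of_red_of_irr (wAllExclAddPotSSAtThreeRankOneRed_of_wAllExclX3 h3)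
    (wAllExclAddPotSSAtThreeRankOneIrr_of_wAllExclX4 h4)

end Summit.BirchSwinnertonDyer

end
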